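import Summits.FinalStateConjecture.FinalStateConjecture.Theorems.EIHFluxBalanceModulatedKerrHandoffOneHoleBoxes
import Summits.FinalStateConjecture.FinalStateConjecture.Theorems.EIHFluxBalanceModulatedKerrHandoffOneHoleClock
import Summits.FinalStateConjecture.FinalStateConjecture.Theorems.EIHFluxBalanceModulatedKerrHandoffOneHoleModuli

/-!
# Route EIHFluxBalance — `ModulatedKerrHandoff`, stub `stub_dragEstimates`: kernel calculus of the drag

Helper file for the crux `stmt-FinalStateConjecture-10167`
(`Summit.FinalStateConjecture.FinalStateConjecture.Theses.EIHFluxBalance.ModulatedKerrHandoff`),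
line `overlap-modulation-second-iterate`, stub `stub_dragEstimates` (the Lie drag of the modulated
multi-Kerr–Schild superposition is below the weight); companion of `…DragSmooth`.

Every field entering the drag terms `Dhᵢ(y)[Aᵢ(y − cᵢ)] + hᵢ(y)(Aᵢ·, ·) + hᵢ(y)(·, Aᵢ·)` is a value of the
ONE smooth kernel of the photon line (`…OneHoleKernel`),
`𝔉(m, L, a′, w) = (g_{m,a′}(0, w) − η)(L·, L·)` on `P = ℝ × (E4 →L E4) × ℝ × E3`, read at a parameter
point `p(y) = (M, Λ(y⁰)⁻¹, εa, ε S Λ(y⁰)⁻¹(y − c(y⁰)))` and scaled by `ε` (`OneHole.boostedKerrBilin_sub_eq_smul_kernel`).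
This file supplies the pointwise `Cᵏ` SIZE bookkeeping (in the conjunction format of `…OneHoleCalculus`)
that the drag estimate consumes:

* `ck_sum` — sizes add over finite sums;
* `fderiv_boostedKsPert_apply` — the FROZEN-moduli derivative through the kernel:
  `D[z ↦ boostedKerrBilin Λ c M a z − η](y)[V] = ε • D𝔉(p)[(0, 0, 0, ε S Λ⁻¹ V)]`;
* `ck_scaledPosition`, `ck₁_paramMap` — size `≤ max C_Θ (8 C_Θ max 1 C_W)` of the parameter map
  along ANY family `y ↦ (m, Θ(y), εa, ε S Θ(y) W(y))` whose frame `Θ` has size `C_Θ` and whose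
  displacement `W` has value `≤ w₀` with `ε w₀ ≤ 1` and positive-order size `C_W` (the scale `ε`
  absorbs the one growing factor — no alignment and no decay of the moduli are needed, only bounds);
* `norm_scaledPosition_le`, `radius_scaledPosition` — the parameter point lies in the kernel box;
* `ck_kernel_comp`, `ck_fderiv_kernel_comp` — Faà di Bruno sizes `6 B (max 1 D)³` of `𝔉 ∘ p` and
  `D𝔉 ∘ p` from a `C⁴` kernel bound `B` (`OneHole.exists_ck_kernel`) and a parameter size `D`;
* `ck_theta_time`, `ck_sub_centre` — the lab-time instances: `y ↦ Λ(y⁰)⁻¹` has size `C_θ A` and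
  `y ↦ y − c(y⁰)` has value `‖y̲ − ξ(y⁰)‖` and positive-order size `2 + A` under tameness AT `y⁰`.

Dieudonné 1960, (8.12); Kerr–Schild 1965, §2–3. [folklore]
-/

noncomputable section

-- `Summit.<S>.<S>.…` (single-problem summit, D-0017) trips core's duplicate-namespace linter.
set_option linter.dupNamespace false

open Set Filter Function Literature.Geometry.Lorentzian
open scoped Topology ContDiff BigOperators

namespace Summit.FinalStateConjecture.FinalStateConjecture.Theorems

namespace Drag

open OneHole

variable {E F G : Type*} [NormedAddCommGroup E] [NormedSpace ℝ E] [NormedAddCommGroup F]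
  [NormedSpace ℝ F] [NormedAddCommGroup G] [NormedSpace ℝ G]

/-! ### Finite sums -/

/-- **Size of a finite sum**: sizes `C j` of the summands at `x` give size `Σ C j` of the sum.
[folklore] -/
theorem ck_sum {ι : Type*} {n : ℕ} {f : ι → E → F} {x : E} {C : ι → ℝ} (s : Finset ι)
    (h : ∀ j ∈ s, ContDiffAt ℝ n (f j) x ∧ ∀ i ≤ n, ‖iteratedFDeriv ℝ i (f j) x‖ ≤ C j) :
    ContDiffAt ℝ n (fun y ↦ ∑ j ∈ s, f j y) x ∧
      ∀ i ≤ n, ‖iteratedFDeriv ℝ i (fun y ↦ ∑ j ∈ s, f j y) x‖ ≤ ∑ j ∈ s, C j := by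
  refine ⟨ContDiffAt.sum fun j hj ↦ (h j hj).1, fun i hi ↦ ?_⟩
  rw [iteratedFDeriv_fun_sum_apply fun j hj ↦ (h j hj).1.of_le (by exact_mod_cast hi)]
  exact (norm_sum_le _ _).trans (Finset.sum_le_sum fun j hj ↦ (h j hj).2 i hi)

/-! ### The frozen-moduli derivative through the kernel -/

/-- **The frozen derivative through the kernel.** For fixed boost `Λ`, centre `c` and scale `ε > 0`,
if the kernel `𝔉` is differentiable at `p = (M, Λ⁻¹, εa, ε S Λ⁻¹(y − c))` then
`D[z ↦ boostedKerrBilin Λ c M a z − η](y)[V] = ε • D𝔉(p)[(0, 0, 0, ε S Λ⁻¹ V)]`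
(chain rule on the kernel identity `boostedKerrBilin Λ c M a z − η = ε • 𝔉(M, Λ⁻¹, εa, ε S Λ⁻¹(z − c))`,
whose inner map is affine in `z`). [folklore] -/
theorem fderiv_boostedKsPert_apply (Λ : lorentzGroup) (c : E4) (M a : ℝ) {ε : ℝ} (hε : 0 < ε) (y V : E4)
    (hd : ContDiffAt ℝ 4 (fun p : ℝ × ((E4 →L[ℝ] E4) × (ℝ × E3)) ↦
      (Kerr.bilin p.1 p.2.2.1 (E4.ofTimeSpace 0 p.2.2.2) - Minkowski.bilin).bilinearComp p.2.1 p.2.1)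
      (M, ((((Λ : E4 ≃L[ℝ] E4).symm : E4 ≃L[ℝ] E4) : E4 →L[ℝ] E4),
        (ε * a, ε • E4.spatial ((Λ : E4 ≃L[ℝ] E4).symm (y - c)))))) :
    fderiv ℝ (fun z ↦ boostedKerrBilin Λ c M a z - Minkowski.bilin) y V =
      ε • fderiv ℝ (fun p : ℝ × ((E4 →L[ℝ] E4) × (ℝ × E3)) ↦
        (Kerr.bilin p.1 p.2.2.1 (E4.ofTimeSpace 0 p.2.2.2) - Minkowski.bilin).bilinearComp p.2.1 p.2.1)
        (M, ((((Λ : E4 ≃L[ℝ] E4).symm : E4 ≃L[ℝ] E4) : E4 →L[ℝ] E4),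
          (ε * a, ε • E4.spatial ((Λ : E4 ≃L[ℝ] E4).symm (y - c)))))
        ((0 : ℝ), ((0 : E4 →L[ℝ] E4), ((0 : ℝ), ε • E4.spatial ((Λ : E4 ≃L[ℝ] E4).symm V)))) := by
  set 𝔉 : ℝ × ((E4 →L[ℝ] E4) × (ℝ × E3)) → E4 →L[ℝ] E4 →L[ℝ] ℝ := fun p ↦
      (Kerr.bilin p.1 p.2.2.1 (E4.ofTimeSpace 0 p.2.2.2) - Minkowski.bilin).bilinearComp p.2.1 p.2.1
    with h𝔉
  set θ : E4 →L[ℝ] E4 := (((Λ : E4 ≃L[ℝ] E4).symm : E4 ≃L[ℝ] E4) : E4 →L[ℝ] E4) with hθ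
  set inner : E4 → ℝ × ((E4 →L[ℝ] E4) × (ℝ × E3)) := fun z ↦
    (M, (θ, (ε * a, ε • E4.spatial ((Λ : E4 ≃L[ℝ] E4).symm (z - c))))) with hinner
  have hfun : (fun z ↦ boostedKerrBilin Λ c M a z - Minkowski.bilin) = fun z ↦ ε • 𝔉 (inner z) :=
    funext fun z ↦ boostedKerrBilin_sub_eq_smul_kernel Λ c M a hε z
  -- the inner affine map and its derivative
  have h4 : HasFDerivAt (fun z : E4 ↦ ε • E4.spatial ((Λ : E4 ≃L[ℝ] E4).symm (z - c)))
      (ε • ((E4.spatial.comp θ).comp (ContinuousLinearMap.id ℝ E4))) y := by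
    have h := ((E4.spatial.comp θ).hasFDerivAt (x := y - c)).comp y ((hasFDerivAt_id y).sub_const c)
    exact h.const_smul ε
  have hin : HasFDerivAt inner
      ((0 : E4 →L[ℝ] ℝ).prod ((0 : E4 →L[ℝ] (E4 →L[ℝ] E4)).prod ((0 : E4 →L[ℝ] ℝ).prod
        (ε • ((E4.spatial.comp θ).comp (ContinuousLinearMap.id ℝ E4)))))) y :=
    (hasFDerivAt_const M y).prodMk ((hasFDerivAt_const θ y).prodMk
      ((hasFDerivAt_const (ε * a) y).prodMk h4))
  have hd' : HasFDerivAt 𝔉 (fderiv ℝ 𝔉 (inner y)) (inner y) :=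
    (hd.differentiableAt (by simp)).hasFDerivAt
  have hcomp : HasFDerivAt (fun z ↦ ε • 𝔉 (inner z)) (ε • ((fderiv ℝ 𝔉 (inner y)).comp
      ((0 : E4 →L[ℝ] ℝ).prod ((0 : E4 →L[ℝ] (E4 →L[ℝ] E4)).prod ((0 : E4 →L[ℝ] ℝ).prod
        (ε • ((E4.spatial.comp θ).comp (ContinuousLinearMap.id ℝ E4)))))))) y :=
    (HasFDerivAt.comp y (g := 𝔉) (g' := fderiv ℝ 𝔉 (inner y)) (f := inner) hd' hin).const_smul ε
  rw [hfun, hcomp.fderiv]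
  simp only [smul_apply, ContinuousLinearMap.coe_comp, Function.comp_apply,
    ContinuousLinearMap.prod_apply, zero_apply, ContinuousLinearMap.coe_id', id_eq]
  rfl

/-! ### The scaled rest-frame position along a family -/

/-- **Size of the scaled rest-frame position along a family.** If the frame `Θ : X → (E4 →L E4)` has
size `C_Θ` at `x` (orders `≤ n`), the displacement `W : X → E4` has `‖W x‖ ≤ w₀` and positive-order
size `C_W ≥ 0`, and the scale satisfies `0 ≤ ε ≤ 1`, `ε w₀ ≤ 1`, then `y ↦ ε S Θ(y) W(y)` has size
`2ⁿ C_Θ max 1 C_W` at `x` (Leibniz; the scale absorbs the value of the displacement). [folklore] -/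
theorem ck_scaledPosition {X : Type*} [NormedAddCommGroup X] [NormedSpace ℝ X] {Θ : X → E4 →L[ℝ] E4}
    {W : X → E4} {x : X} {n : ℕ} {CΘ w₀ CW ε : ℝ}
    (hΘ : ContDiffAt ℝ n Θ x ∧ ∀ i ≤ n, ‖iteratedFDeriv ℝ i Θ x‖ ≤ CΘ)
    (hW : ContDiffAt ℝ n W x ∧ ∀ i, 1 ≤ i → i ≤ n → ‖iteratedFDeriv ℝ i W x‖ ≤ CW)
    (hw₀ : ‖W x‖ ≤ w₀) (hCW : 0 ≤ CW) (hε0 : 0 ≤ ε) (hε1 : ε ≤ 1) (hεw : ε * w₀ ≤ 1) :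
    ContDiffAt ℝ n (fun y ↦ ε • E4.spatial (Θ y (W y))) x ∧
      ∀ i ≤ n, ‖iteratedFDeriv ℝ i (fun y ↦ ε • E4.spatial (Θ y (W y))) x‖ ≤ 2 ^ n * CΘ * max 1 CW := by
  have hCΘ : 0 ≤ CΘ := ck_nonneg hΘ
  have h1 := ck_clm_apply hΘ (ck_of_ck₁ hW hw₀)
  have h2 := ck_const_smul (ck_clm_comp_left h1 (E4.spatial : E4 →L[ℝ] E3)) ε
  refine ck_mono h2 le_rfl ?_
  rw [abs_of_nonneg hε0]
  have hS := norm_spatial_le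
  have hm : ε * max w₀ CW ≤ max 1 CW := by
    rcases le_total w₀ CW with h | h
    · rw [max_eq_right h]
      exact (mul_le_of_le_one_left hCW hε1).trans (le_max_right _ _)
    · rw [max_eq_left h]
      exact hεw.trans (le_max_left _ _)
  have h0 : 0 ≤ 2 ^ n * CΘ := by positivity
  calc ε * (‖(E4.spatial : E4 →L[ℝ] E3)‖ * (2 ^ n * CΘ * max w₀ CW))
      = ‖(E4.spatial : E4 →L[ℝ] E3)‖ * ((2 ^ n * CΘ) * (ε * max w₀ CW)) := by ring
    _ ≤ 1 * ((2 ^ n * CΘ) * max 1 CW) := by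
        refine mul_le_mul hS (mul_le_mul_of_nonneg_left hm h0) ?_ zero_le_one
        have : 0 ≤ ε * max w₀ CW := mul_nonneg hε0 ((norm_nonneg _).trans (hw₀.trans (le_max_left _ _)))
        positivity
    _ = 2 ^ n * CΘ * max 1 CW := by ring

/-- **Positive-order size of the parameter map along a family**:
`y ↦ (m, Θ(y), εa′, ε S Θ(y) W(y)) ∈ P` has derivatives of orders `1 … 3` bounded by
`max C_Θ (8 C_Θ max 1 C_W)` under the hypotheses of `ck_scaledPosition` (`n = 3`). [folklore] -/
theorem ck₁_paramMap {X : Type*} [NormedAddCommGroup X] [NormedSpace ℝ X] {Θ : X → E4 →L[ℝ] E4}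
    {W : X → E4} {x : X} {CΘ w₀ CW ε : ℝ} (m a' : ℝ)
    (hΘ : ContDiffAt ℝ 3 Θ x ∧ ∀ i ≤ 3, ‖iteratedFDeriv ℝ i Θ x‖ ≤ CΘ)
    (hW : ContDiffAt ℝ 3 W x ∧ ∀ i, 1 ≤ i → i ≤ 3 → ‖iteratedFDeriv ℝ i W x‖ ≤ CW)
    (hw₀ : ‖W x‖ ≤ w₀) (hCW : 0 ≤ CW) (hε0 : 0 ≤ ε) (hε1 : ε ≤ 1) (hεw : ε * w₀ ≤ 1) :
    ContDiffAt ℝ 3 (fun y ↦ ((m, (Θ y, (a', ε • E4.spatial (Θ y (W y))))) :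
        ℝ × ((E4 →L[ℝ] E4) × (ℝ × E3)))) x ∧
      ∀ i, 1 ≤ i → i ≤ 3 → ‖iteratedFDeriv ℝ i (fun y ↦ ((m, (Θ y, (a', ε • E4.spatial (Θ y (W y))))) :
        ℝ × ((E4 →L[ℝ] E4) × (ℝ × E3)))) x‖ ≤ max CΘ (8 * CΘ * max 1 CW) := by
  have hCΘ : 0 ≤ CΘ := ck_nonneg hΘ
  have h4 := ck_scaledPosition hΘ hW hw₀ hCW hε0 hε1 hεw
  rw [show (2 : ℝ) ^ 3 = 8 by norm_num] at h4
  have h := ck₁_prodMk (ck₁_const 3 m x) (ck₁_prodMk (ck₁_of_ck hΘ)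
    (ck₁_prodMk (ck₁_const 3 a' x) (ck₁_of_ck h4)))
  refine ck₁_mono h le_rfl ?_
  have hK : 0 ≤ 8 * CΘ * max 1 CW := by positivity
  rw [max_eq_right hK, max_eq_right (le_max_of_le_left hCΘ)]

/-- **The scaled rest-frame position stays in the box**: `‖ε S Θ W‖ ≤ L_b` when `‖Θ‖ ≤ L_b`,
`‖W‖ ≤ w₀`, `ε w₀ ≤ 1`, `ε ≥ 0`. [folklore] -/
theorem norm_scaledPosition_le {Θ : E4 →L[ℝ] E4} {W : E4} {Lb w₀ ε : ℝ} (hΘ : ‖Θ‖ ≤ Lb) (hW : ‖W‖ ≤ w₀)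
    (hε0 : 0 ≤ ε) (hεw : ε * w₀ ≤ 1) : ‖ε • E4.spatial (Θ W)‖ ≤ Lb := by
  have hLb : 0 ≤ Lb := (norm_nonneg _).trans hΘ
  rw [norm_smul, Real.norm_eq_abs, abs_of_nonneg hε0]
  have h1 : ‖E4.spatial (Θ W)‖ ≤ Lb * w₀ := by
    refine ((E4.spatial : E4 →L[ℝ] E3).le_opNorm _).trans ?_
    calc ‖(E4.spatial : E4 →L[ℝ] E3)‖ * ‖Θ W‖ ≤ 1 * (‖Θ‖ * ‖W‖) :=
          mul_le_mul norm_spatial_le (Θ.le_opNorm W) (norm_nonneg _) zero_le_one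
      _ ≤ Lb * w₀ := by rw [one_mul]; exact mul_le_mul hΘ hW (norm_nonneg _) hLb
  calc ε * ‖E4.spatial (Θ W)‖ ≤ ε * (Lb * w₀) := mul_le_mul_of_nonneg_left h1 hε0
    _ = Lb * (ε * w₀) := by ring
    _ ≤ Lb * 1 := mul_le_mul_of_nonneg_left hεw hLb
    _ = Lb := mul_one _

/-- **The rest-frame radius of the scaled position**: `r_{εa}(0, ε S z) = ε r_a(z)` for `ε > 0`
(homogeneity, and the radius only sees the spatial part). [folklore] -/
theorem radius_scaledPosition {ε : ℝ} (hε : 0 < ε) (a : ℝ) (z : E4) :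
    Kerr.radius (ε * a) (E4.ofTimeSpace 0 (ε • E4.spatial z)) = ε * Kerr.radius a z := by
  rw [radius_slice_smul hε, Kerr.radius_eq_of_spatial_eq a (E4.spatial_ofTimeSpace 0 (E4.spatial z))]

/-! ### Faà di Bruno through the kernel -/

/-- **Size of the kernel along a parameter map**: a `C⁴` kernel bound `B` at `p x` and a positive-order
`C³` size `D` of `p` at `x` give `C³` size `6 B (max 1 D)³` of `𝔉 ∘ p` at `x`. [folklore] -/
theorem ck_kernel_comp {X P : Type*} [NormedAddCommGroup X] [NormedSpace ℝ X] [NormedAddCommGroup P]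
    [NormedSpace ℝ P] {𝔉 : P → F} {p : X → P} {x : X} {B D : ℝ}
    (hB : ContDiffAt ℝ 4 𝔉 (p x) ∧ ∀ i ≤ 4, ‖iteratedFDeriv ℝ i 𝔉 (p x)‖ ≤ B)
    (hp : ContDiffAt ℝ 3 p x ∧ ∀ i, 1 ≤ i → i ≤ 3 → ‖iteratedFDeriv ℝ i p x‖ ≤ D) :
    ContDiffAt ℝ 3 (fun y ↦ 𝔉 (p y)) x ∧
      ∀ i ≤ 3, ‖iteratedFDeriv ℝ i (fun y ↦ 𝔉 (p y)) x‖ ≤ 6 * B * max 1 D ^ 3 := by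
  have h := ck_comp (ck_mono hB (by norm_num : 3 ≤ 4) le_rfl) hp
  rwa [show (Nat.factorial 3 : ℝ) = 6 by norm_num] at h

/-- **Size of the kernel's derivative along a parameter map**: under the same hypotheses `D𝔉 ∘ p`
has `C³` size `6 B (max 1 D)³` at `x` (order shift `OneHole.ck_fderiv`). [folklore] -/
theorem ck_fderiv_kernel_comp {X P : Type*} [NormedAddCommGroup X] [NormedSpace ℝ X]
    [NormedAddCommGroup P] [NormedSpace ℝ P] {𝔉 : P → F} {p : X → P} {x : X} {B D : ℝ}
    (hB : ContDiffAt ℝ 4 𝔉 (p x) ∧ ∀ i ≤ 4, ‖iteratedFDeriv ℝ i 𝔉 (p x)‖ ≤ B)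
    (hp : ContDiffAt ℝ 3 p x ∧ ∀ i, 1 ≤ i → i ≤ 3 → ‖iteratedFDeriv ℝ i p x‖ ≤ D) :
    ContDiffAt ℝ 3 (fun y ↦ fderiv ℝ 𝔉 (p y)) x ∧
      ∀ i ≤ 3, ‖iteratedFDeriv ℝ i (fun y ↦ fderiv ℝ 𝔉 (p y)) x‖ ≤ 6 * B * max 1 D ^ 3 := by
  have hB' : ContDiffAt ℝ (3 + 1 : ℕ) 𝔉 (p x) ∧
      ∀ i, 1 ≤ i → i ≤ 3 + 1 → ‖iteratedFDeriv ℝ i 𝔉 (p x)‖ ≤ B :=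
    ⟨hB.1, fun i _ hi ↦ hB.2 i hi⟩
  have h := ck_comp (ck_fderiv hB') hp
  rwa [show (Nat.factorial 3 : ℝ) = 6 by norm_num] at h

/-! ### The lab-time instances: frame and displacement read at `y⁰` -/

section LabTime

variable {Λ : ℝ → lorentzGroup} {ξ : ℝ → E3} {A Cθ : ℝ}

/-- **Size of the inverse frame read at lab time.** With `‖(Λ⁻¹)⁽ᵏ⁾‖ ≤ C_θ ‖Λ⁽ᵏ⁾‖` (`…OneHoleModuli`)
and `‖Λ⁽ᵏ⁾(x⁰)‖ ≤ A` for `k ≤ 4` (tameness AT the lab time of `x`, order zero included),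
`y ↦ Λ(y⁰)⁻¹` has size `C_θ A` at `x` up to order `n ≤ 4`. [folklore] -/
theorem ck_theta_time (hΛ : ContDiff ℝ ∞ (fun t ↦ ((Λ t : E4 ≃L[ℝ] E4) : E4 →L[ℝ] E4))) (hC0 : 0 ≤ Cθ)
    (hCθ : ∀ (k : ℕ) (u : ℝ),
      ‖iteratedDeriv k (fun t ↦ (((Λ t : E4 ≃L[ℝ] E4).symm : E4 ≃L[ℝ] E4) : E4 →L[ℝ] E4)) u‖ ≤
        Cθ * ‖iteratedDeriv k (fun t ↦ ((Λ t : E4 ≃L[ℝ] E4) : E4 →L[ℝ] E4)) u‖)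
    {x : E4} (hA : ∀ k ≤ 4, ‖iteratedDeriv k (fun t ↦ ((Λ t : E4 ≃L[ℝ] E4) : E4 →L[ℝ] E4)) (x 0)‖ ≤ A)
    {n : ℕ} (hn : n ≤ 4) :
    ContDiffAt ℝ n (fun y : E4 ↦ (((Λ (y 0) : E4 ≃L[ℝ] E4).symm : E4 ≃L[ℝ] E4) : E4 →L[ℝ] E4)) x ∧
      ∀ i ≤ n, ‖iteratedFDeriv ℝ i
        (fun y : E4 ↦ (((Λ (y 0) : E4 ≃L[ℝ] E4).symm : E4 ≃L[ℝ] E4) : E4 →L[ℝ] E4)) x‖ ≤ Cθ * A := by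
  have hθ := contDiff_theta hΛ
  refine ⟨((hθ.comp (EuclideanSpace.proj (0 : Fin 4) (𝕜 := ℝ)).contDiff).of_le
    (by exact_mod_cast le_top)).contDiffAt, fun i hi ↦ ?_⟩
  refine (norm_iteratedFDeriv_comp_time_le hθ x (by exact_mod_cast le_top)).trans ?_
  exact (hCθ i (x 0)).trans (mul_le_mul_of_nonneg_left (hA i (hi.trans hn)) hC0)

/-- **Size of the displacement from the simultaneous centre.** `y ↦ y − c(y⁰)`, `c(t) = (t, ξ(t))`,
has value `‖x̲ − ξ(x⁰)‖` at `x` and, with `‖ξ⁽ᵏ⁾(x⁰)‖ ≤ A` for `1 ≤ k ≤ 4`, derivatives of orders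
`1 … n` (`n ≤ 4`) bounded by `2 + A`. [folklore] -/
theorem ck_sub_centre (hξ : ContDiff ℝ ∞ ξ) {x : E4}
    (hA : ∀ k, 1 ≤ k → k ≤ 4 → ‖iteratedDeriv k ξ (x 0)‖ ≤ A) {n : ℕ} (hn : n ≤ 4) :
    (ContDiffAt ℝ n (fun y : E4 ↦ y - E4.ofTimeSpace (y 0) (ξ (y 0))) x ∧
      ∀ i, 1 ≤ i → i ≤ n →
        ‖iteratedFDeriv ℝ i (fun y : E4 ↦ y - E4.ofTimeSpace (y 0) (ξ (y 0))) x‖ ≤ 2 + A) ∧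
      ‖x - E4.ofTimeSpace (x 0) (ξ (x 0))‖ = ‖E4.spatial x - ξ (x 0)‖ := by
  have hc := contDiff_centre hξ
  refine ⟨⟨(contDiffAt_id.sub ((hc.comp (EuclideanSpace.proj (0 : Fin 4) (𝕜 := ℝ)).contDiff).of_le
    (by exact_mod_cast le_top)).contDiffAt), fun i hi1 hi ↦ ?_⟩, (sub_ofTimeSpace_apply_zero rfl _).2⟩
  refine (norm_iteratedFDeriv_sub_centre_le hc x hi1 (by exact_mod_cast le_top)).trans ?_
  have h1 := norm_iteratedDeriv_centre_le hξ (x 0) hi1 (by exact_mod_cast le_top)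
  have h2 := hA i hi1 (hi.trans hn)
  linarith

end LabTime

end Drag

/-- Registered sub-goal form (stub `drag_radius_scaledPosition` of the crux item) of
`Drag.radius_scaledPosition`: `r_{εa}(0, ε S z) = ε r_a(z)` for `ε > 0`. [folklore] -/
theorem drag_radius_scaledPosition : open Literature.Geometry.Lorentzian in ∀ {ε : ℝ}, 0 < ε → ∀ (a : ℝ) (z : E4), Kerr.radius (ε * a) (E4.ofTimeSpace 0 (ε • E4.spatial z)) = ε * Kerr.radius a z :=
  fun hε a z ↦ Drag.radius_scaledPosition hε a z

end Summit.FinalStateConjecture.FinalStateConjecture.Theorems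

end
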